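import Mathlib
import HarnessLib
import Summits.AtomisticToContinuum.BoseEinsteinCondensation.Theses.GapWindowLadder

/-!
# GapWindowLadder — the free-case excision glue `FreeExcisionGlue`

Closes the glue item `stmt-AtomisticToContinuum-28033` of `route-AtomisticToContinuum-GapWindowLadder`
(split gen 1 of the declared residual `GapWindowResponse`, stmt-AtomisticToContinuum-27583, decomp-a2c lens-6 g14):

  `FreeExcisionGlue : GapWindowResponseFree → GapWindowResponsePos → GapWindowResponse`

by the case split `scatteringLength v = 0 ∨ 0 < scatteringLength v` (`scatteringLength v : ℝ≥0`). Both children are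
trivially WEAKER than the parent (drop the extra hypothesis), so `GapWindowResponse ⟺ Free ∧ Pos`; the converses are
kept in the cell node `run/shared/lean/pub/decomp-a2c/decomp-a2c-lens-6/g14/NodeGapWindowLadderFreeExcision.lean`, not
here (a `Parent → Child` theorem would read as a conditional proof of the child).
-/

namespace Summit.AtomisticToContinuum.BoseEinsteinCondensation.Theorems.GapWindowLadderFreeExcisionGlue

open Summit.AtomisticToContinuum.BoseEinsteinCondensation.Theses.GapWindowLadder
open Literature.MathematicalPhysics.QuantumManyBody.BoseGas

/-- the glue item: the parent law follows from its zero- and positive-scattering-length restrictions. -/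
theorem freeExcisionGlue : FreeExcisionGlue := by
  intro hf hp v hv
  rcases eq_zero_or_pos (a := scatteringLength v) with h0 | hpos
  · exact hf v hv h0
  · exact hp v hv hpos

end Summit.AtomisticToContinuum.BoseEinsteinCondensation.Theorems.GapWindowLadderFreeExcisionGlue
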